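import Literature.Geometry.Kaehler.ComplexTorusCMTypeModelsImprimitiveDegreeLeTwelveHodgeClasses
import HarnessLib

/-!
# Non-simple complex tori of dimension `≤ 6` with an endomorphism of cyclotomic characteristic polynomial `Φ_d` (`φ(d) ≤ 12`): the Hodge classes
# of all their powers are generated by divisor classes

Layer `Literature/Geometry/Kaehler`, namespace `Literature.Geometry.Kaehler.ComplexTorus`; lane `lit-hodgefound` (Track 2 foundations library),
prover seat `lit-hodgefound-p10`, generation 33, row «A2-26(ho)» (self-proposed 2026-08-28).  Theorems only; no `def`, no instance, no named fact
(net Literature debt 0).  Sequel of `ComplexTorusCMTypeModelsImprimitiveDegreeLeTwelveHodgeClasses` (models of non-primitive types, degree `≤ 12`)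
and of this generation's `ComplexTorusCyclotomicCharpolyHodgeClassesDegreeLeEight` (`φ(d) ≤ 8`, simple or not).

A complex torus `X` with an endomorphism `u`, `P_u = Φ_d`, `d > 2`, is `≅ ℂ^g/Φ(𝔞)` for a CM type `Φ` of `ℚ(ζ_d)` (generation 31,
`exists_cmType_ideal_iso_of_charpoly_eq_cyclotomic`), `2g = φ(d)`; `X` non-simple ⟺ `Φ` not primitive; for `φ(d) ≤ 12` — `d ∈ {…, 13, 21, 26, 28,
36, 42}` included — the sibling gives `Hdg = Div` on all powers of the model, transported along the isomorphism.  (The SIMPLE tori with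
`φ(d) ∈ {10, 12}` are not treated: the primitive types of `ℚ(ζ₁₁)`, `ℚ(ζ₁₃)`, `ℚ(ζ₂₁)`, … need their own rank computations.)

* **`divisorClasses_powPeriod_eq_hodgeClasses_of_not_isSimple_of_charpoly_eq_cyclotomic_of_totient_le_twelve`**, and the dimension form
  **`divisorClasses_powPeriod_eq_hodgeClasses_of_not_isSimple_of_charpoly_eq_cyclotomic_of_finrank_le_six`** (`dim X ≤ 6`).

## References

* [MoonenZarhin1999LowDim] B. Moonen, Yu. Zarhin, Math. Ann. 315 (1999), Thm. 0.1, (0.2)(4).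
* [Shimura1998] G. Shimura (1998), §6.1 Thm. 2, §6.2 Thm. 3, §8.2 Prop. 26.
* [BirkenhakeLange2004] Ch. Birkenhake, H. Lange, *Complex Abelian Varieties*, 2nd ed. (2004), §13.3.
-/

noncomputable section

open scoped Classical nonZeroDivisors NumberField Manifold ContDiff MatrixGroups
open NumberField Module Polynomial

namespace Literature.Geometry.Kaehler

namespace ComplexTorus

open Literature.AlgebraicGeometry.Motives (CMType)
open Literature.NumberTheory.ComplexMultiplication.CMTypeLattice (periodIso)
open Literature.AlgebraicGeometry.Pohlmann1968.Cyclotomic (finrank_eq_totient)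

variable {ι : Type} [Fintype ι] [DecidableEq ι] {E : Type} [NormedAddCommGroup E] [NormedSpace ℂ E]
  {P : (ι → ℝ) ≃L[ℝ] E} {d : ℕ}

set_option backward.isDefEq.respectTransparency false in -- Mathlib's instance
-- `IsCyclotomicExtension {d} ℚ (CyclotomicField d ℚ)` is keyed on `CyclotomicField.algebra`, the goal on
-- `DivisionRing.toRatAlgebra` (same workaround as `ComplexTorusCMTypeModelsHodgeClassesDegreeLeSix`)
/-- **`Hdg(Xᵏ) = Div(Xᵏ)` FOR ALL `k`, FOR EVERY NON-SIMPLE COMPLEX TORUS WITH AN ENDOMORPHISM OF CHARACTERISTIC POLYNOMIAL `Φ_d`, `d > 2`,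
`φ(d) ≤ 12`** (`X ≅ ℂ^g/Φ(𝔞)` with `Φ` not primitive; `X ∼ Bⁿ`, `n ≥ 2`, `dim B ≤ 3`). [cite: MoonenZarhin1999LowDim, Thm. 0.1, (0.2)(4)]
[cite: Shimura1998, §6.1 Thm. 2, §6.2 Thm. 3, §8.2 Prop. 26] [cite: BirkenhakeLange2004, §13.3] -/
theorem divisorClasses_powPeriod_eq_hodgeClasses_of_not_isSimple_of_charpoly_eq_cyclotomic_of_totient_le_twelve (hd : 2 < d)
    (h12 : Nat.totient d ≤ 12) (hns : ¬ ComplexTorus.IsSimple P) {A : Matrix ι ι ℤ} (hA : A ∈ endRingInt P)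
    (hP : A.charpoly = cyclotomic d ℤ) (k p : ℕ) :
    divisorClasses (powPeriod P k) p = hodgeClasses (powPeriod P k) p := by
  haveI : NeZero d := ⟨by omega⟩
  have hζ := IsCyclotomicExtension.zeta_spec d ℚ (CyclotomicField d ℚ)
  obtain ⟨Φ, I, e, he, he₂, -⟩ := exists_cmType_ideal_iso_of_charpoly_eq_cyclotomic hζ hA hP
  haveI : IsCMField (CyclotomicField d ℚ) :=
    IsCyclotomicExtension.Rat.isCMField (CyclotomicField d ℚ) (S := ({d} : Set ℕ)) ⟨d, rfl, hd⟩
  have hK : finrank ℚ (CyclotomicField d ℚ) ≤ 12 := by rw [finrank_eq_totient d (CyclotomicField d ℚ)]; exact h12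
  have hX : IsIsomorphic P (periodIso Φ I) := ⟨e, he, he₂⟩
  have hns' : ¬ ComplexTorus.IsSimple (periodIso Φ I) := fun h ↦ hns (hX.isSimple_iff.2 h)
  exact (hX.isIsogenous.forall_powPeriod_divisorClasses_eq_hodgeClasses_iff.2
    (fun k p ↦ divisorClasses_powPeriod_periodIso_eq_hodgeClasses_of_not_isSimple_of_finrank_le_twelve hK Φ I hns' k p)) k p

/-- **The same for NON-SIMPLE complex tori of dimension `≤ 6`** (`2 dim X = φ(d)`) with an endomorphism of cyclotomic characteristic polynomial
`Φ_d`, `d > 2`. [cite: MoonenZarhin1999LowDim, Thm. 0.1, (0.2)(4)] [cite: BirkenhakeLange2004, §13.3] -/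
theorem divisorClasses_powPeriod_eq_hodgeClasses_of_not_isSimple_of_charpoly_eq_cyclotomic_of_finrank_le_six (hd : 2 < d)
    (h6 : finrank ℂ E ≤ 6) (hns : ¬ ComplexTorus.IsSimple P) {A : Matrix ι ι ℤ} (hA : A ∈ endRingInt P)
    (hP : A.charpoly = cyclotomic d ℤ) (k p : ℕ) :
    divisorClasses (powPeriod P k) p = hodgeClasses (powPeriod P k) p := by
  have h := two_mul_finrank_eq_totient_of_charpoly_eq_cyclotomic P hP
  exact divisorClasses_powPeriod_eq_hodgeClasses_of_not_isSimple_of_charpoly_eq_cyclotomic_of_totient_le_twelve hd (by omega) hns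
    hA hP k p

end ComplexTorus

end Literature.Geometry.Kaehler

end
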